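import Summits.BirchSwinnertonDyer.BirchSwinnertonDyer.Theses.TwoAdicConverse
import Summits.BirchSwinnertonDyer.Rank1Residual.X5.TwoAdicAdditiveL2
import Summits.BirchSwinnertonDyer.Rank1Residual.X5.TwoAdicAdditiveL2Converse
import Summits.BirchSwinnertonDyer.BirchSwinnertonDyer.Theorems.TwoAdicConverseTwistSupply
import Literature.NumberTheory.EllipticCurves.BSDSelmerCMPConverseProofs
import HarnessLib

/-!
# Route `TwoAdicConverse` (rung S3), crux `GoodOrdinaryRankZeroTwoConverse` (item
# stmt-BirchSwinnertonDyer-19218): the BC3 birth skeleton's RN-2 road, composed against the route decl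
# with its twist-supply stub DISCHARGED (Hoffstein–Luo) — one open stub left, the converse over `K`

Cell `bsd-2adic` (run/shared/lean/pub/bsd-2adic/), seat `bsd-2adic-conv-1`; the good-ordinary twin of
`Theorems/TwoAdicConverseMultiplicativeInputs.lean` (seat bsd-2adic-mult, p409715/p411646). THEOREMS
ONLY; nothing asserted, no definition, no named fact introduced.

The planner's BC3 birth skeleton of the crux (evidence `GoodOrdinaryRankZeroTwoConverse_birth.lean`,
plan/routes/TwoAdicConverse/bc/post/) is the RN-2 road = the cell's PROVED 2-converse assembly
`X5.AddTwoL2.analyticRank_eq_of_selmerCorank_two_eq`: choose an auxiliary quadratic field `K` with `2`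
SPLIT in `K` (`X5.AddTwoL2Cyc.TwoSplit K`, `d_K ≡ 1 (mod 8)`) and `L(E^(d_K),1) ≠ 0`; Kato's
finiteness at `2` (Cor. 14.3, printed for every `p`) kills the twist's Selmer corank,
Dokchitser–Dokchitser Lemma 4.14 adds coranks under quadratic base change, and the corank-`0`
2-CONVERSE OVER `K` (`X5.AddTwoL2.TwoConverseOverAt W K 0` — the Burungale–Skinner–Tian–Wan Thm. 4.3 /
Prop. 4.1 shape with its one excluded prime `p = 2` put back) concludes. Its three stubs:
`stub_print` = PRINT {`kato_finite_of_L_one_ne_zero · 2`, `selmerCorank_baseChange_quadratic`,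
`hasEntireLFunction_rat`} (named facts, displayed); `stub_twist` = the twist supply with the local
condition «`2` split» — DISCHARGED for EVERY `E/ℚ` modulo the PRINT fact
`HoffsteinLuo1997_exists_twist_L_one_ne_zero` by the landed
`existsNonvanishingTwistWith_twoSplit_of_hoffsteinLuo` (Theorems/TwoAdicConverseTwistSupply.lean);
`stub_overK` = the converse over `K`, ∀-closed over non-CM curves good ordinary at `2` — the ONE open
object of this road (no theorem in print at `p = 2`: BSTW Thm. 4.3 has «p ∤ 2N»).

* `goodOrdinaryRankZeroTwoConverse_of_overK` — the birth composition `GoodOrdinaryRankZeroTwoConverse_of`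
  stated against the REGISTERED crux decl with the tree's predicate `TwoSplit` (in place of the
  skeleton's local `TwoSplitIn`): PRINT bundle + twist supply + converse over `K` ⇒ crux.
* `goodOrdinaryRankZeroTwoConverse_of_overK_of_hoffsteinLuo` — the same with the twist-supply binder
  replaced by Hoffstein–Luo: PRINT {Kato 14.3@2, DD 4.14, modularity, Hoffstein–Luo} + converse over
  `K` ⇒ crux.

This road is the ALTERNATIVE to the cyclotomic (Eisenstein-half) road through which the item was split
(children 19167/19151, glue p416617): it needs no `2`-adic main conjecture over `ℚ` but a corank-`0`
converse over an imaginary/real quadratic `K` with `2` split (two-variable / anticyclotomic `2`-adic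
input). HONEST FRAMING: composition certificates; the crux stays open; no class is closed. PARTITION
(D-0054): none — RANK axis (S3); companion formula cell X5@2 good-ord (B1·O1; 611 book230 classes),
owner bsd-2adic.

References: [Kato2004Asterisque] Cor. 14.3; [DokchitserDokchitser2010] Lemma 4.14;
[BurungaleSkinnerTianWan2024] Thm. 4.3 / Prop. 4.1 (arXiv:2409.01350 p. 82); [HoffsteinLuo1997]
Theorem (§1, pp. 435–436); [BCDTJAMS2001] Thm. A.
-/

set_option autoImplicit false
set_option linter.dupNamespace false

noncomputable section

open scoped Classical

open WeierstrassCurve Literature.NumberTheory.EllipticCurves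
  Literature.NumberTheory.EllipticCurves.Rank1Residual
  Summit.BirchSwinnertonDyer.Rank1Residual.X5

namespace Summit.BirchSwinnertonDyer.BirchSwinnertonDyer.Theorems

/-- **Bridge (RN-2 road ⇒ crux `GoodOrdinaryRankZeroTwoConverse`).** The PRINT bundle (Kato Cor. 14.3
at `2`, Dokchitser–Dokchitser L. 4.14, modularity) + the twist supply «a quadratic `K` with `2` split
and `L(E^(d_K),1) ≠ 0» + the corank-`0` 2-converse OVER such `K`, each ∀-closed over non-CM `E/ℚ`
good ordinary at `2`, imply the crux, by the proved assembly
`AddTwoL2.analyticRank_eq_of_selmerCorank_two_eq` with admissibility predicate `AddTwoL2Cyc.TwoSplit`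
(the planner's birth composition `GoodOrdinaryRankZeroTwoConverse_of`, on the route decl).
Composition certificate; nothing asserted. [cite: Kato2004Asterisque, Cor 14.3]
[cite: DokchitserDokchitser2010, Lemma 4.14]
[cite: BurungaleSkinnerTianWan2024, Thm 4.3 and Prop 4.1 (arXiv:2409.01350 p. 82)] -/
theorem goodOrdinaryRankZeroTwoConverse_of_overK
    (hP : (∀ (V : WeierstrassCurve ℚ) [V.IsElliptic], kato_finite_of_L_one_ne_zero V 2) ∧
      selmerCorank_baseChange_quadratic ∧ hasEntireLFunction_rat)
    (hT : ∀ (W : WeierstrassCurve ℚ) [W.IsElliptic] [W.IsGloballyMinimal],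
      ¬ W.HasCM → GoodOrd W 2 →
        AddTwoL2.ExistsNonvanishingTwistWith W (fun K _ _ => AddTwoL2Cyc.TwoSplit K))
    (hK : ∀ (W : WeierstrassCurve ℚ) [W.IsElliptic] [W.IsGloballyMinimal],
      ¬ W.HasCM → GoodOrd W 2 → ∀ (K : Type) [Field K] [NumberField K], Module.finrank ℚ K = 2 →
        AddTwoL2Cyc.TwoSplit K → (W.quadraticTwist (NumberField.discr K : ℚ)).entireLFunction 1 ≠ 0 →
        AddTwoL2.TwoConverseOverAt W K 0) :
    Summit.BirchSwinnertonDyer.BirchSwinnertonDyer.Theses.TwoAdicConverse.GoodOrdinaryRankZeroTwoConverse := by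
  unfold Summit.BirchSwinnertonDyer.BirchSwinnertonDyer.Theses.TwoAdicConverse.GoodOrdinaryRankZeroTwoConverse
  intro W _ _ hcm hgo hsel
  exact AddTwoL2.analyticRank_eq_of_selmerCorank_two_eq W (fun K _ _ => AddTwoL2Cyc.TwoSplit K) hP.1
    hP.2.1 hP.2.2 (hT W hcm hgo) 0 (fun K _ _ h2 hPK hL => hK W hcm hgo K h2 hPK hL) hsel

/-- **Bridge (RN-2 road ⇒ crux, twist supply discharged).** As
`goodOrdinaryRankZeroTwoConverse_of_overK` with the twist-supply binder replaced by the named PRINT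
fact `HoffsteinLuo1997_exists_twist_L_one_ne_zero` (via the landed
`existsNonvanishingTwistWith_twoSplit_of_hoffsteinLuo`, which holds for EVERY `E/ℚ`): PRINT bundle +
Hoffstein–Luo + the corank-`0` 2-converse over every quadratic `K` with `2` split and
`L(E^(d_K),1) ≠ 0` ⇒ `GoodOrdinaryRankZeroTwoConverse`. So the RN-2 road of item 19218 has ONE open
∀-closed input, `AddTwoL2.TwoConverseOverAt W K 0` on the class.
[cite: HoffsteinLuo1997, Theorem (§1, pp. 435–436)] [cite: Kato2004Asterisque, Cor 14.3]
[cite: DokchitserDokchitser2010, Lemma 4.14]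
[cite: BurungaleSkinnerTianWan2024, Thm 4.3 and Prop 4.1 (arXiv:2409.01350 p. 82)] -/
theorem goodOrdinaryRankZeroTwoConverse_of_overK_of_hoffsteinLuo
    (hP : (∀ (V : WeierstrassCurve ℚ) [V.IsElliptic], kato_finite_of_L_one_ne_zero V 2) ∧
      selmerCorank_baseChange_quadratic ∧ hasEntireLFunction_rat)
    (hHL : HoffsteinLuo1997_exists_twist_L_one_ne_zero)
    (hK : ∀ (W : WeierstrassCurve ℚ) [W.IsElliptic] [W.IsGloballyMinimal],
      ¬ W.HasCM → GoodOrd W 2 → ∀ (K : Type) [Field K] [NumberField K], Module.finrank ℚ K = 2 →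
        AddTwoL2Cyc.TwoSplit K → (W.quadraticTwist (NumberField.discr K : ℚ)).entireLFunction 1 ≠ 0 →
        AddTwoL2.TwoConverseOverAt W K 0) :
    Summit.BirchSwinnertonDyer.BirchSwinnertonDyer.Theses.TwoAdicConverse.GoodOrdinaryRankZeroTwoConverse :=
  goodOrdinaryRankZeroTwoConverse_of_overK hP
    (fun W _ _ _ _ => existsNonvanishingTwistWith_twoSplit_of_hoffsteinLuo hHL W) hK

end Summit.BirchSwinnertonDyer.BirchSwinnertonDyer.Theorems

end
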